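import Literature.NumberTheory.Sieve.FractionPhases
import HarnessLib

/-!
# Complete sums to squarefree moduli as products over primes (Polymath 8a, proof of Proposition 4.6)

Topic `Literature/NumberTheory/Sieve`, grouping namespace `Polymath8a`; a support file for the named
fact `Literature.NumberTheory.Sieve.mpz_of_lt` (**parity.S29**, `ParityWave0.lean`), continuing
`FractionPhases.lean`.  Source: D. H. J. Polymath, *New equidistribution estimates of Zhang type*,
Algebra & Number Theory 8:9 (2014) 2067–2199 = arXiv:1402.0811, §4.3, proof of **Proposition 4.6**:
"By Lemma 4.4, we can factor the sum as a product of exponential sums over the prime divisors of `q`: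
`∑_{n ∈ ℤ/qℤ} e_q(f(n)) = ∏_{p ∣ q} ∑_{n ∈ ℤ/pℤ} e_p(f(n)/(q/p))`.  Since, for each `p ∣ q`, the constant
`q/p` is an invertible element in `ℤ/pℤ`, we see that it suffices to prove the [local] estimates."
We PROVE this global-to-local mechanism for the phases of the paper (one-pole phases `e_d(c/(n+l))`
and the additive twists `e_q(hn)` produced by completion of sums, Lemma 4.9):

* `Polymath8a.sum_range_prod_of_periodic` — for a finite set `s` of primes and `p`-periodic
  `F_p : ℤ → ℂ`, `∑_{0 ≤ j < ∏_{p∈s} p} ∏_{p ∈ s} F_p(j) = ∏_{p ∈ s} ∑_{0 ≤ j < p} F_p(j)`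
  (iterating `sum_range_mul_of_coprime_periodic`), and `Polymath8a.norm_sum_range_prod_le` — a product
  of local bounds is a global bound;
* `Polymath8a.fourierChar_eq_eFrac_one` — the additive twist of completion of sums is a fraction phase,
  `e(ja/q) = e_q(ja/1)`, so that Lemma 4.4 splits it over the primes as well;
* `Polymath8a.norm_twoPhase_twisted_le_prod` — **global from local** for the twisted complete sums
  `T(h) = ∑_{j mod [d₁,d₂]} e_{d₁}(c₁/(u₁(j+l₁))) e_{d₂}(c₂/(u₂(j+l₂))) e_{[d₁,d₂]}(jh/v)` attached by
  Lemma 4.9 to the phases of Corollary 4.16 / Proposition 5.10: if every local sum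
  `∑_{j mod p} [p∣d₁] e_p(c₁/(w₁(j+l₁))) [p∣d₂] e_p(c₂/(w₂(j+l₂))) e_p(jh/w)` (`p ∣ [d₁,d₂]` prime,
  `w₁, w₂, w` units) has modulus `≤ B(p)`, then `|T(h)| ≤ ∏_{p ∣ [d₁,d₂]} B(p)` (squarefree `d₁, d₂`;
  induction over the primes, one prime at a time, by Lemma 4.4).

Everything is PROVED (theorems only; no definitions, no named facts).  The local sums themselves
(Ramanujan, Kloosterman, the two-pole Möbius reduction) are in `FractionPhasesLocal.lean`.

## References

* D. H. J. Polymath, *New equidistribution estimates of Zhang type*, Algebra & Number Theory 8:9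
  (2014) 2067–2199, arXiv:1402.0811: Lemma 4.4, Proposition 4.6 (proof, first display).
  [cite: Polymath8a2014, Proposition 4.6, proof]
-/

noncomputable section

open Finset Real
open scoped FourierTransform

namespace Literature.NumberTheory.Sieve

namespace Polymath8a

/-! ### Products of periodic functions over a set of primes -/

/-- A product of primes is squarefree and positive bookkeeping: `∏_{p ∈ s} p ≠ 0`. [folklore] -/
theorem prod_primes_ne_zero {s : Finset ℕ} (hs : ∀ p ∈ s, p.Prime) : (∏ p ∈ s, p) ≠ 0 :=
  Finset.prod_ne_zero_iff.mpr fun p hp => (hs p hp).ne_zero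

/-- A product of `p`-periodic functions over `p ∈ s` is `(∏_{p∈s} p)`-periodic. [folklore] -/
theorem prod_periodic {s : Finset ℕ} {F : ℕ → ℤ → ℂ}
    (hF : ∀ p ∈ s, ∀ m n : ℤ, F p (m + p * n) = F p m) (m n : ℤ) :
    ∏ p ∈ s, F p (m + ((∏ p' ∈ s, p' : ℕ) : ℤ) * n) = ∏ p ∈ s, F p m := by
  refine Finset.prod_congr rfl fun p hp => ?_
  obtain ⟨k, hk⟩ : p ∣ ∏ p' ∈ s, p' := Finset.dvd_prod_of_mem _ hp
  rw [hk]
  push_cast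
  rw [show m + (p : ℤ) * k * n = m + p * (k * n) by ring]
  exact hF p hp m (k * n)

/-- **Factorisation of complete sums over the primes of a squarefree modulus** (proof of
Proposition 4.6, first display: "we can factor the sum as a product of exponential sums over the prime
divisors of `q`"): for a finite set `s` of primes and `p`-periodic `F_p`,
`∑_{0 ≤ j < ∏_{p∈s} p} ∏_{p∈s} F_p(j) = ∏_{p∈s} ∑_{0 ≤ j < p} F_p(j)`.
[cite: Polymath8a2014, Proposition 4.6, proof] -/
theorem sum_range_prod_of_periodic {s : Finset ℕ} (hs : ∀ p ∈ s, p.Prime) {F : ℕ → ℤ → ℂ}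
    (hF : ∀ p ∈ s, ∀ m n : ℤ, F p (m + p * n) = F p m) :
    ∑ j ∈ Finset.range (∏ p ∈ s, p), ∏ p ∈ s, F p j = ∏ p ∈ s, ∑ j ∈ Finset.range p, F p j := by
  classical
  induction s using Finset.induction_on with
  | empty => simp
  | insert p s hps ih =>
    have hp : p.Prime := hs p (Finset.mem_insert_self p s)
    have hs' : ∀ p' ∈ s, p'.Prime := fun p' hp' => hs p' (Finset.mem_insert_of_mem hp')
    have hF' : ∀ p' ∈ s, ∀ m n : ℤ, F p' (m + p' * n) = F p' m :=
      fun p' hp' => hF p' (Finset.mem_insert_of_mem hp')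
    rw [Finset.prod_insert hps, Finset.prod_insert hps, ← ih hs' hF']
    have hcop : p.Coprime (∏ p' ∈ s, p') := by
      refine Nat.Coprime.prod_right fun p' hp' => (Nat.coprime_primes hp (hs' p' hp')).mpr ?_
      rintro rfl; exact hps hp'
    rw [← sum_range_mul_of_coprime_periodic hcop hp.ne_zero (prod_primes_ne_zero hs')
      (F := F p) (G := fun m : ℤ => ∏ p' ∈ s, F p' m) (hF p (Finset.mem_insert_self p s))
      (fun m n => prod_periodic hF' m n)]
    exact Finset.sum_congr rfl fun j _ => Finset.prod_insert hps

/-- **A product of local bounds is a global bound**: under the hypotheses of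
`sum_range_prod_of_periodic`, if `|∑_{j<p} F_p(j)| ≤ B_p` for every `p ∈ s` then
`|∑_{j < ∏ p} ∏_p F_p(j)| ≤ ∏_p B_p`. [cite: Polymath8a2014, Proposition 4.6, proof] -/
theorem norm_sum_range_prod_le {s : Finset ℕ} (hs : ∀ p ∈ s, p.Prime) {F : ℕ → ℤ → ℂ}
    (hF : ∀ p ∈ s, ∀ m n : ℤ, F p (m + p * n) = F p m) {B : ℕ → ℝ}
    (hB : ∀ p ∈ s, ‖∑ j ∈ Finset.range p, F p j‖ ≤ B p) :
    ‖∑ j ∈ Finset.range (∏ p ∈ s, p), ∏ p ∈ s, F p j‖ ≤ ∏ p ∈ s, B p := by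
  rw [sum_range_prod_of_periodic hs hF, norm_prod]
  exact Finset.prod_le_prod (fun p _ => norm_nonneg _) hB

/-! ### The twisted two-phase complete sums of Corollary 4.16: global from local -/

/-- The additive twist `e(ja/q)` of completion of sums is the fraction phase `e_q(ja/1)`.
[folklore] -/
theorem fourierChar_eq_eFrac_one {q : ℕ} [NeZero q] (j a : ℤ) :
    (𝐞 ((j : ℝ) * a / q) : ℂ) = eFrac q (j * a) 1 := by
  rw [eFrac_of_isUnit (by push_cast; exact isUnit_one),
    show ((j * a : ℤ) : ZMod q) * ((1 : ℤ) : ZMod q)⁻¹ = ((j * a : ℤ) : ZMod q) by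
      rw [Int.cast_one, show (1 : ZMod q)⁻¹ = 1 from by
        simpa only [one_mul] using ZMod.mul_inv_of_unit (1 : ZMod q) isUnit_one, mul_one],
    ZMod.stdAddChar_coe, Real.fourierChar_apply]
  congr 1
  push_cast
  ring

/-- Periodicity of the twist factor `j ↦ e_q(jh/v)` modulo `q`. [folklore] -/
theorem eFrac_mul_right_periodic {q : ℕ} [NeZero q] (h v : ℤ) (m n : ℤ) :
    eFrac q ((m + q * n) * h) v = eFrac q (m * h) v := by
  refine eFrac_congr_left ?_ v
  push_cast
  rw [ZMod.natCast_self]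
  ring

/-- **Global from local for the twisted two-phase complete sums** (the mechanism of the proof of
Proposition 4.6 — "we can factor the sum as a product of exponential sums over the prime divisors of
`q` … it suffices to prove the [local] estimates" — for the sums
`T(h) = ∑_{j mod [d₁,d₂]} e_{d₁}(c₁/(u₁(j+l₁))) e_{d₂}(c₂/(u₂(j+l₂))) e_{[d₁,d₂]}(jh/v)` that completion
of sums (Lemma 4.9) attaches to the phases of Corollary 4.16): if for every prime `p ∣ [d₁, d₂]` and all
unit multipliers `w₁, w₂, w` the local sum
`∑_{j mod p} [p∣d₁] e_p(c₁/(w₁(j+l₁))) · [p∣d₂] e_p(c₂/(w₂(j+l₂))) · e_p(jh/w)` has modulus `≤ B(p)`,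
then `|T(h)| ≤ ∏_{p ∣ [d₁,d₂]} B(p)` (squarefree `d₁, d₂`; `u_i` coprime to `d_i`, `v` coprime to
`[d₁, d₂]`).  Proof: induction over the primes of `[d₁, d₂]`, splitting one prime at a time with
Lemma 4.4 and `sum_range_mul_of_coprime_periodic`. [cite: Polymath8a2014, Proposition 4.6, proof] -/
theorem norm_twoPhase_twisted_le_prod (D : ℕ) :
    ∀ (d₁ d₂ : ℕ) [NeZero d₁] [NeZero d₂] (hd₁ : Squarefree d₁) (hd₂ : Squarefree d₂)
      (hD : Nat.lcm d₁ d₂ = D) (c₁ c₂ l₁ l₂ u₁ u₂ h v : ℤ) (hu₁ : IsCoprime u₁ d₁) (hu₂ : IsCoprime u₂ d₂)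
      (hv : IsCoprime v D) (B : ℕ → ℝ)
      (hB : ∀ p : ℕ, (hp : p.Prime) → p ∣ D → ∀ (w₁ w₂ w : ℤ),
          IsCoprime w₁ p → IsCoprime w₂ p → IsCoprime w p →
          (haveI : NeZero p := ⟨hp.ne_zero⟩;
            ‖∑ j ∈ Finset.range p, (if p ∣ d₁ then eFrac p c₁ (w₁ * (j + l₁)) else 1) *
                (if p ∣ d₂ then eFrac p c₂ (w₂ * (j + l₂)) else 1) * eFrac p (j * h) w‖ ≤ B p)),
        (haveI : NeZero D := ⟨hD ▸ Nat.lcm_ne_zero hd₁.ne_zero hd₂.ne_zero⟩;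
          ‖∑ j ∈ Finset.range D, eFrac d₁ c₁ (u₁ * (j + l₁)) * eFrac d₂ c₂ (u₂ * (j + l₂)) *
              eFrac D (j * h) v‖ ≤ ∏ p ∈ D.primeFactors, B p) := by
  induction D using Nat.strong_induction_on with
  | _ D ih =>
  -- the step at a prime dividing `d₁`
  have key : ∀ (d₁ d₂ : ℕ) [NeZero d₁] [NeZero d₂] (hd₁ : Squarefree d₁) (hd₂ : Squarefree d₂)
      (hD : Nat.lcm d₁ d₂ = D) (p : ℕ) (hp : p.Prime) (hpd₁ : p ∣ d₁) (c₁ c₂ l₁ l₂ u₁ u₂ h v : ℤ)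
      (hu₁ : IsCoprime u₁ d₁) (hu₂ : IsCoprime u₂ d₂) (hv : IsCoprime v D) (B : ℕ → ℝ)
      (hB : ∀ p : ℕ, (hp : p.Prime) → p ∣ D → ∀ (w₁ w₂ w : ℤ),
          IsCoprime w₁ p → IsCoprime w₂ p → IsCoprime w p →
          (haveI : NeZero p := ⟨hp.ne_zero⟩;
            ‖∑ j ∈ Finset.range p, (if p ∣ d₁ then eFrac p c₁ (w₁ * (j + l₁)) else 1) *
                (if p ∣ d₂ then eFrac p c₂ (w₂ * (j + l₂)) else 1) * eFrac p (j * h) w‖ ≤ B p)),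
        (haveI : NeZero D := ⟨hD ▸ Nat.lcm_ne_zero hd₁.ne_zero hd₂.ne_zero⟩;
          ‖∑ j ∈ Finset.range D, eFrac d₁ c₁ (u₁ * (j + l₁)) * eFrac d₂ c₂ (u₂ * (j + l₂)) *
              eFrac D (j * h) v‖ ≤ ∏ p ∈ D.primeFactors, B p) := by
    intro d₁ d₂ _ _ hd₁ hd₂ hD p hp hpd₁ c₁ c₂ l₁ l₂ u₁ u₂ h v hu₁ hu₂ hv B hB
    haveI : NeZero p := ⟨hp.ne_zero⟩
    obtain ⟨e₁, rfl, hpe₁, he₁⟩ := exists_eq_prime_mul_of_squarefree hp hd₁ hpd₁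
    haveI : NeZero e₁ := ⟨he₁.ne_zero⟩
    have hcop₁ : p.Coprime e₁ := (Nat.Prime.coprime_iff_not_dvd hp).mpr hpe₁
    have hpZe₁ : IsCoprime (p : ℤ) (e₁ : ℤ) := Nat.isCoprime_iff_coprime.mpr hcop₁
    have hu₁' : IsCoprime u₁ ((p : ℤ) * e₁) := by exact_mod_cast hu₁
    have hu₁p : IsCoprime u₁ (p : ℤ) := hu₁'.of_mul_right_left
    have hu₁e : IsCoprime u₁ (e₁ : ℤ) := hu₁'.of_mul_right_right
    have hsplit₁ : ∀ n : ℕ, eFrac (p * e₁) c₁ (u₁ * (n + l₁)) =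
        eFrac p c₁ (e₁ * u₁ * (n + l₁)) * eFrac e₁ c₁ (p * u₁ * (n + l₁)) :=
      fun n => eFrac_prime_mul_split hcop₁ c₁ u₁ _
    -- the cofactor `E` and the factorisation `D = p E`, in the two cases `p ∣ d₂`, `p ∤ d₂`
    by_cases hpd₂ : p ∣ d₂
    · obtain ⟨e₂, rfl, hpe₂, he₂⟩ := exists_eq_prime_mul_of_squarefree hp hd₂ hpd₂
      haveI : NeZero e₂ := ⟨he₂.ne_zero⟩
      have hcop₂ : p.Coprime e₂ := (Nat.Prime.coprime_iff_not_dvd hp).mpr hpe₂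
      have hpZe₂ : IsCoprime (p : ℤ) (e₂ : ℤ) := Nat.isCoprime_iff_coprime.mpr hcop₂
      have hu₂' : IsCoprime u₂ ((p : ℤ) * e₂) := by exact_mod_cast hu₂
      have hu₂p : IsCoprime u₂ (p : ℤ) := hu₂'.of_mul_right_left
      have hu₂e : IsCoprime u₂ (e₂ : ℤ) := hu₂'.of_mul_right_right
      have hsplit₂ : ∀ n : ℕ, eFrac (p * e₂) c₂ (u₂ * (n + l₂)) =
          eFrac p c₂ (e₂ * u₂ * (n + l₂)) * eFrac e₂ c₂ (p * u₂ * (n + l₂)) :=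
        fun n => eFrac_prime_mul_split hcop₂ c₂ u₂ _
      set E : ℕ := Nat.lcm e₁ e₂ with hE
      haveI : NeZero E := ⟨Nat.lcm_ne_zero he₁.ne_zero he₂.ne_zero⟩
      have hE0 : E ≠ 0 := NeZero.ne E
      have hDE : D = p * E := by rw [← hD, Nat.lcm_mul_left]
      have hpE : p.Coprime E :=
        Nat.Coprime.coprime_dvd_right (Nat.lcm_dvd_mul e₁ e₂) (Nat.Coprime.mul_right hcop₁ hcop₂)
      have hpZE : IsCoprime (p : ℤ) (E : ℤ) := Nat.isCoprime_iff_coprime.mpr hpE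
      subst hDE
      have hElt : E < p * E := lt_mul_left (Nat.pos_of_ne_zero hE0) hp.one_lt
      have hv' : IsCoprime v ((p : ℤ) * E) := by exact_mod_cast hv
      have hvp : IsCoprime v (p : ℤ) := hv'.of_mul_right_left
      have hvE : IsCoprime v (E : ℤ) := hv'.of_mul_right_right
      -- split the twist
      have hsplit₃ : ∀ n : ℕ, eFrac (p * E) (n * h) v = eFrac p (n * h) (E * v) * eFrac E (n * h) (p * v) :=
        fun n => eFrac_mul_of_coprime hpE _ _
      have hsum : ∑ j ∈ Finset.range (p * E), eFrac (p * e₁) c₁ (u₁ * (j + l₁)) *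
            eFrac (p * e₂) c₂ (u₂ * (j + l₂)) * eFrac (p * E) (j * h) v =
          (∑ j ∈ Finset.range p, eFrac p c₁ (e₁ * u₁ * (j + l₁)) * eFrac p c₂ (e₂ * u₂ * (j + l₂)) *
              eFrac p (j * h) (E * v)) *
          ∑ j ∈ Finset.range E, eFrac e₁ c₁ (p * u₁ * (j + l₁)) * eFrac e₂ c₂ (p * u₂ * (j + l₂)) *
              eFrac E (j * h) (p * v) := by
        rw [← sum_range_mul_of_coprime_periodic hpE hp.ne_zero hE0
          (F := fun m : ℤ => eFrac p c₁ (e₁ * u₁ * (m + l₁)) * eFrac p c₂ (e₂ * u₂ * (m + l₂)) *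
            eFrac p (m * h) (E * v))
          (G := fun m : ℤ => eFrac e₁ c₁ (p * u₁ * (m + l₁)) * eFrac e₂ c₂ (p * u₂ * (m + l₂)) *
            eFrac E (m * h) (p * v))]
        · refine Finset.sum_congr rfl fun n _ => ?_
          rw [hsplit₁, hsplit₂, hsplit₃]; ring
        · intro m k
          rw [eFrac_arg_add_of_dvd (dvd_mul_right _ _), eFrac_arg_add_of_dvd (dvd_mul_right _ _),
            eFrac_mul_right_periodic]
        · intro m k
          rw [eFrac_arg_add_of_dvd (Dvd.dvd.mul_right (Int.natCast_dvd_natCast.mpr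
              (Nat.dvd_lcm_left e₁ e₂)) k),
            eFrac_arg_add_of_dvd (Dvd.dvd.mul_right (Int.natCast_dvd_natCast.mpr
              (Nat.dvd_lcm_right e₁ e₂)) k), eFrac_mul_right_periodic]
      rw [hsum, norm_mul]
      -- the local factor
      have hloc := hB p hp (dvd_mul_right p E) (e₁ * u₁) (e₂ * u₂) (E * v)
        (IsCoprime.mul_left hpZe₁.symm hu₁p) (IsCoprime.mul_left hpZe₂.symm hu₂p)
        (IsCoprime.mul_left hpZE.symm hvp)
      simp only [dvd_mul_right p e₁, dvd_mul_right p e₂, if_true] at hloc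
      -- the cofactor by induction
      have hB' : ∀ p' : ℕ, (hp' : p'.Prime) → p' ∣ E → ∀ (w₁ w₂ w : ℤ),
          IsCoprime w₁ p' → IsCoprime w₂ p' → IsCoprime w p' →
          (haveI : NeZero p' := ⟨hp'.ne_zero⟩;
            ‖∑ j ∈ Finset.range p', (if p' ∣ e₁ then eFrac p' c₁ (w₁ * (j + l₁)) else 1) *
                (if p' ∣ e₂ then eFrac p' c₂ (w₂ * (j + l₂)) else 1) * eFrac p' (j * h) w‖ ≤ B p') := by
        intro p' hp' hp'E w₁ w₂ w hw₁ hw₂ hw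
        have hne : p' ≠ p := by rintro rfl; exact (Nat.Prime.coprime_iff_not_dvd hp).mp hpE hp'E
        have i₁ : (p' ∣ p * e₁) = (p' ∣ e₁) := propext ⟨fun hh => ((Nat.Prime.dvd_mul hp').mp hh).resolve_left
          (fun hh' => hne ((Nat.prime_dvd_prime_iff_eq hp' hp).mp hh')), fun hh => hh.mul_left p⟩
        have i₂ : (p' ∣ p * e₂) = (p' ∣ e₂) := propext ⟨fun hh => ((Nat.Prime.dvd_mul hp').mp hh).resolve_left
          (fun hh' => hne ((Nat.prime_dvd_prime_iff_eq hp' hp).mp hh')), fun hh => hh.mul_left p⟩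
        have hh := hB p' hp' (hp'E.mul_left p) w₁ w₂ w hw₁ hw₂ hw
        simp only [i₁, i₂] at hh
        exact hh
      have hrec := ih E hElt e₁ e₂ he₁ he₂ rfl c₁ c₂ l₁ l₂ (p * u₁) (p * u₂) h (p * v)
        (IsCoprime.mul_left hpZe₁ hu₁e) (IsCoprime.mul_left hpZe₂ hu₂e) (IsCoprime.mul_left hpZE hvE) B hB'
      -- the prime factors of `p E`
      have hpf : (p * E).primeFactors = insert p E.primeFactors := by
        rw [Nat.primeFactors_mul hp.ne_zero hE0, hp.primeFactors]; rfl
      have hpnot : p ∉ E.primeFactors := fun hh => (Nat.Prime.coprime_iff_not_dvd hp).mp hpE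
        (Nat.dvd_of_mem_primeFactors hh)
      rw [hpf, Finset.prod_insert hpnot]
      exact mul_le_mul hloc hrec (norm_nonneg _) ((norm_nonneg _).trans hloc)
    · -- `p ∤ d₂`
      have hcop₂ : p.Coprime d₂ := (Nat.Prime.coprime_iff_not_dvd hp).mpr hpd₂
      set E : ℕ := Nat.lcm e₁ d₂ with hE
      haveI : NeZero E := ⟨Nat.lcm_ne_zero he₁.ne_zero hd₂.ne_zero⟩
      have hE0 : E ≠ 0 := NeZero.ne E
      have hDE : D = p * E := by rw [← hD, lcm_prime_mul_left hcop₂]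
      have hpE : p.Coprime E :=
        Nat.Coprime.coprime_dvd_right (Nat.lcm_dvd_mul e₁ d₂) (Nat.Coprime.mul_right hcop₁ hcop₂)
      have hpZE : IsCoprime (p : ℤ) (E : ℤ) := Nat.isCoprime_iff_coprime.mpr hpE
      subst hDE
      have hElt : E < p * E := lt_mul_left (Nat.pos_of_ne_zero hE0) hp.one_lt
      have hv' : IsCoprime v ((p : ℤ) * E) := by exact_mod_cast hv
      have hvp : IsCoprime v (p : ℤ) := hv'.of_mul_right_left
      have hvE : IsCoprime v (E : ℤ) := hv'.of_mul_right_right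
      have hsplit₃ : ∀ n : ℕ, eFrac (p * E) (n * h) v = eFrac p (n * h) (E * v) * eFrac E (n * h) (p * v) :=
        fun n => eFrac_mul_of_coprime hpE _ _
      have hsum : ∑ j ∈ Finset.range (p * E), eFrac (p * e₁) c₁ (u₁ * (j + l₁)) *
            eFrac d₂ c₂ (u₂ * (j + l₂)) * eFrac (p * E) (j * h) v =
          (∑ j ∈ Finset.range p, eFrac p c₁ (e₁ * u₁ * (j + l₁)) * eFrac p (j * h) (E * v)) *
          ∑ j ∈ Finset.range E, eFrac e₁ c₁ (p * u₁ * (j + l₁)) * eFrac d₂ c₂ (u₂ * (j + l₂)) *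
              eFrac E (j * h) (p * v) := by
        rw [← sum_range_mul_of_coprime_periodic hpE hp.ne_zero hE0
          (F := fun m : ℤ => eFrac p c₁ (e₁ * u₁ * (m + l₁)) * eFrac p (m * h) (E * v))
          (G := fun m : ℤ => eFrac e₁ c₁ (p * u₁ * (m + l₁)) * eFrac d₂ c₂ (u₂ * (m + l₂)) *
            eFrac E (m * h) (p * v))]
        · refine Finset.sum_congr rfl fun n _ => ?_
          rw [hsplit₁, hsplit₃]; ring
        · intro m k
          rw [eFrac_arg_add_of_dvd (dvd_mul_right _ _), eFrac_mul_right_periodic]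
        · intro m k
          rw [eFrac_arg_add_of_dvd (Dvd.dvd.mul_right (Int.natCast_dvd_natCast.mpr
              (Nat.dvd_lcm_left e₁ d₂)) k),
            eFrac_arg_add_of_dvd (Dvd.dvd.mul_right (Int.natCast_dvd_natCast.mpr
              (Nat.dvd_lcm_right e₁ d₂)) k), eFrac_mul_right_periodic]
      rw [hsum, norm_mul]
      have hloc := hB p hp (dvd_mul_right p E) (e₁ * u₁) 1 (E * v)
        (IsCoprime.mul_left hpZe₁.symm hu₁p) isCoprime_one_left (IsCoprime.mul_left hpZE.symm hvp)
      simp only [dvd_mul_right p e₁, if_true, hpd₂, if_false, mul_one] at hloc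
      have hB' : ∀ p' : ℕ, (hp' : p'.Prime) → p' ∣ E → ∀ (w₁ w₂ w : ℤ),
          IsCoprime w₁ p' → IsCoprime w₂ p' → IsCoprime w p' →
          (haveI : NeZero p' := ⟨hp'.ne_zero⟩;
            ‖∑ j ∈ Finset.range p', (if p' ∣ e₁ then eFrac p' c₁ (w₁ * (j + l₁)) else 1) *
                (if p' ∣ d₂ then eFrac p' c₂ (w₂ * (j + l₂)) else 1) * eFrac p' (j * h) w‖ ≤ B p') := by
        intro p' hp' hp'E w₁ w₂ w hw₁ hw₂ hw
        have hne : p' ≠ p := by rintro rfl; exact (Nat.Prime.coprime_iff_not_dvd hp).mp hpE hp'E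
        have i₁ : (p' ∣ p * e₁) = (p' ∣ e₁) := propext ⟨fun hh => ((Nat.Prime.dvd_mul hp').mp hh).resolve_left
          (fun hh' => hne ((Nat.prime_dvd_prime_iff_eq hp' hp).mp hh')), fun hh => hh.mul_left p⟩
        have hh := hB p' hp' (hp'E.mul_left p) w₁ w₂ w hw₁ hw₂ hw
        simp only [i₁] at hh
        exact hh
      have hrec := ih E hElt e₁ d₂ he₁ hd₂ rfl c₁ c₂ l₁ l₂ (p * u₁) u₂ h (p * v)
        (IsCoprime.mul_left hpZe₁ hu₁e) hu₂ (IsCoprime.mul_left hpZE hvE) B hB'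
      have hpf : (p * E).primeFactors = insert p E.primeFactors := by
        rw [Nat.primeFactors_mul hp.ne_zero hE0, hp.primeFactors]; rfl
      have hpnot : p ∉ E.primeFactors := fun hh => (Nat.Prime.coprime_iff_not_dvd hp).mp hpE
        (Nat.dvd_of_mem_primeFactors hh)
      rw [hpf, Finset.prod_insert hpnot]
      exact mul_le_mul hloc hrec (norm_nonneg _) ((norm_nonneg _).trans hloc)
  -- the induction step proper
  intro d₁ d₂ _ _ hd₁ hd₂ hD c₁ c₂ l₁ l₂ u₁ u₂ h v hu₁ hu₂ hv B hB
  have hD0 : D ≠ 0 := by rw [← hD]; exact Nat.lcm_ne_zero hd₁.ne_zero hd₂.ne_zero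
  haveI : NeZero D := ⟨hD0⟩
  by_cases hD1 : D = 1
  · have h1 : d₁ = 1 := Nat.dvd_one.mp (hD1 ▸ hD ▸ Nat.dvd_lcm_left d₁ d₂)
    have h2 : d₂ = 1 := Nat.dvd_one.mp (hD1 ▸ hD ▸ Nat.dvd_lcm_right d₁ d₂)
    subst h1; subst h2; subst hD1
    simp [eFrac_one_left]
  · obtain ⟨p, hp, hpD'⟩ := Nat.exists_prime_and_dvd hD1
    have hpD : p ∣ d₁ * d₂ := hpD'.trans (hD ▸ Nat.lcm_dvd_mul d₁ d₂)
    rcases (Nat.Prime.dvd_mul hp).mp hpD with hpd₁ | hpd₂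
    · exact key d₁ d₂ hd₁ hd₂ hD p hp hpd₁ c₁ c₂ l₁ l₂ u₁ u₂ h v hu₁ hu₂ hv B hB
    · -- symmetry `1 ↔ 2`
      have hB'' : ∀ p : ℕ, (hp : p.Prime) → p ∣ D → ∀ (w₁ w₂ w : ℤ),
          IsCoprime w₁ p → IsCoprime w₂ p → IsCoprime w p →
          (haveI : NeZero p := ⟨hp.ne_zero⟩;
            ‖∑ j ∈ Finset.range p, (if p ∣ d₂ then eFrac p c₂ (w₁ * (j + l₂)) else 1) *
                (if p ∣ d₁ then eFrac p c₁ (w₂ * (j + l₁)) else 1) * eFrac p (j * h) w‖ ≤ B p) := by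
        intro p' hp' hp'D w₁ w₂ w hw₁ hw₂ hw
        haveI : NeZero p' := ⟨hp'.ne_zero⟩
        have hh := hB p' hp' hp'D w₂ w₁ w hw₂ hw₁ hw
        have hcomm : ∑ j ∈ Finset.range p', (if p' ∣ d₂ then eFrac p' c₂ (w₁ * (j + l₂)) else 1) *
              (if p' ∣ d₁ then eFrac p' c₁ (w₂ * (j + l₁)) else 1) * eFrac p' (j * h) w =
            ∑ j ∈ Finset.range p', (if p' ∣ d₁ then eFrac p' c₁ (w₂ * (j + l₁)) else 1) *
              (if p' ∣ d₂ then eFrac p' c₂ (w₁ * (j + l₂)) else 1) * eFrac p' (j * h) w :=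
          Finset.sum_congr rfl fun j _ => by ring
        rw [hcomm]
        exact hh
      have hk := key d₂ d₁ hd₂ hd₁ (by rw [Nat.lcm_comm, hD]) p hp hpd₂ c₂ c₁ l₂ l₁ u₂ u₁ h v hu₂ hu₁
        hv B hB''
      have hcomm : ∑ j ∈ Finset.range D, eFrac d₁ c₁ (u₁ * (j + l₁)) * eFrac d₂ c₂ (u₂ * (j + l₂)) *
            eFrac D (j * h) v = ∑ j ∈ Finset.range D, eFrac d₂ c₂ (u₂ * (j + l₂)) *
              eFrac d₁ c₁ (u₁ * (j + l₁)) * eFrac D (j * h) v :=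
        Finset.sum_congr rfl fun j _ => by ring
      rw [hcomm]
      exact hk

end Polymath8a

end Literature.NumberTheory.Sieve
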